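import Summits.ResolutionOfSingularities.ResolutionOfSingularities.Theorems.FrobeniusLadderFInjectiveMacaulayficationRMonoidFreeBasis
import Summits.ResolutionOfSingularities.ResolutionOfSingularities.Theorems.FrobeniusLadderFInjectiveMacaulayficationRMonoidFloorFull
import Summits.ResolutionOfSingularities.ResolutionOfSingularities.Theorems.FrobeniusLadderFInjectiveMacaulayficationToricRingSplitting
import Summits.ResolutionOfSingularities.ResolutionOfSingularities.Theorems.FrobeniusLadderFInjectiveMacaulayficationFlatIntegralCM
import Summits.ResolutionOfSingularities.ResolutionOfSingularities.Theorems.WildQuotientsWildQuotientResolutionToricChartNoetherian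
import HarnessLib

/-!
# ★★ T-TOR IN-HOUSE for the recurrent-monoid bed: `U_R = Spec k[R]` is FULL (domain, Cohen–Macaulay, every ideal Frobenius closed) at EVERY point,
# and the floor `X₁ = Bl_{Sing_red} U_R` of T″-instance #6 is FULL at every closed point UNCONDITIONALLY
# (crux `FInjectiveMacaulayfication` stmt-ResolutionOfSingularities-15315, chain w45a; res-L1-w45a-plan-1 RULING R23.13 (2) + ADDENDUM + GO 06:28:28Z
# «T-TOR in-house, scoped: (F) = (SAT′), (CM) = (FREE′)»; seat res-L1-w45a-lead-1 g13)

[OURS · L1 W4.5a] Support file (`--supports stmt-ResolutionOfSingularities-15315 --as helper`); def-free; UNCONDITIONAL; no named fact; NOT a statement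
of any manuscript; replaces the role of NO printed item (on paper: Hochster 1972 «normal semigroup rings are Cohen–Macaulay» + Hochster–Roberts «… and F-pure»
for THIS bed — the print T-TOR stays unadmitted; this is OURS, from finite certificates). AI-written (AI review is weaker than expert review). Nothing of the
crux is proved here.

ASSEMBLY for `k[R] = ToricChart.Ring k PEmpty RMonoidDefs.rDatum ≅ k[x₁, x₃, x₄, x₂x₃x₄, x₂x₄², x₁x₂x₄, x₁x₂x₃]`, every field `k` of characteristic `p`:
* §1 ★ `free_and_finite` — `k[R]` is a FREE `k[Y₀..Y₃]`-module of rank `5` on `B = (1, x₁x₂x₃, x₂x₃x₄, x₁x₂²x₃²x₄, x₂x₄²)` via `Y ↦ θ =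
  (x₁+x₂x₃x₄, x₃+x₂x₄², x₄+x₁x₂x₃, x₁x₂x₄)` (✓`RMonoidSpanning.wordElem_wordOf_mem` + ✓`RMonoidFreeBasis.bElem_linearIndependent_aeval` /
  `span_wordElem_wordOf_eq_top`), hence flat and integral over the regular ring `k[Y]`;
* §2 `cmCl_localization_rDatum`, `cmCl_stalk_rDatum` — the Cohen–Macaulay clause at EVERY prime / stalk (stub-3 g10 ✓`FlatIntegralCM.cmCl_localization_of_isRegularRing`);
* §3 ★★ `fullCl_localization_rDatum`, `fullCl_stalk_rDatum` — `FullCl p` at EVERY point of `U_R`: domain ✓, CM clause §2, F-clause by the Frobenius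
  SPLITTING (✓`ToricRingSplitting.fClause_localization_toricRing` with ✓`RMonoidSaturated.rDatum_saturated_prime`);
* §4 ★★★ `fullCl_stalk_floor_of_closed` — the hypothesis `hR` of ✓p701502 `RMonoidFloorFull.fullCl_stalk_floor_of_closed` DISCHARGED: the floor
  `X₁ = Bl_{Sing_red} U_R` of T″-instance #6 (`RMonoidTStep.tStepInstanceAt_recurrentMonoid_rDatum`) is FULL at every CLOSED point, for every field `k`
  of characteristic `p` — no T-TOR hypothesis left.
[cite: Hochster1972 (context); HochsterRoberts1976 (context); BrunsHerzog1998, Thm. 2.1.2, Thm. 6.3.5 (context)]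
-/

-- single-problem summit: the doubled namespace component is forced
set_option linter.dupNamespace false

noncomputable section

open MvPolynomial

namespace Summit.ResolutionOfSingularities.ResolutionOfSingularities.Theorems.FInjectiveMacaulayfication.RMonoidFull

open AlgebraicGeometry Literature.AlgebraicGeometry.Resolution
open Summit.ResolutionOfSingularities.ResolutionOfSingularities.Theorems.FInjectiveMacaulayfication RMonoidFreeDefs RMonoidStraightening
  RMonoidSpanning RMonoidFreeBasis SliceableCentre
open Summit.ResolutionOfSingularities.ResolutionOfSingularities.Theorems.WildQuotientResolution.ToricChart

variable (k : Type) [Field k]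

/-! ## §1 `k[R]` is free of rank 5 and finite over `k[Y₀..Y₃]` (via `Y ↦ θ`) -/

/-- `θ^a = aeval θ (Y^a)`. [plumbing] -/
theorem thetaPow_eq_aeval (a : Fin 4 → ℕ) :
    thetaPow k a = MvPolynomial.aeval (thetaFun k) (monomial (Finsupp.equivFunOnFinite.symm a) (1 : k)) := by
  rw [MvPolynomial.aeval_monomial, map_one, one_mul, Finsupp.prod_fintype _ _ (fun i => pow_zero _)]
  simp [thetaPow]

/-- ★ **`B` is a `k[Y]`-basis of `k[R]`**: for the algebra structure `Y_s ↦ θ_s`, `k[R]` is a free and finite `k[Y₀..Y₃]`-module.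
[OURS · L1 W4.5a; cite: BrunsHerzog1998, Thm. 2.1.2 (context)] -/
theorem free_and_finite :
    @Module.Free (MvPolynomial (Fin 4) k) (Ring k PEmpty RMonoidDefs.rDatum) _ _
        (MvPolynomial.aeval (thetaFun k)).toRingHom.toAlgebra.toModule ∧
      @Module.Finite (MvPolynomial (Fin 4) k) (Ring k PEmpty RMonoidDefs.rDatum) _ _
        (MvPolynomial.aeval (thetaFun k)).toRingHom.toAlgebra.toModule := by
  letI alg : Algebra (MvPolynomial (Fin 4) k) (Ring k PEmpty RMonoidDefs.rDatum) := (MvPolynomial.aeval (thetaFun k)).toRingHom.toAlgebra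
  letI mod : Module (MvPolynomial (Fin 4) k) (Ring k PEmpty RMonoidDefs.rDatum) := alg.toModule
  have hsmul : ∀ (f : MvPolynomial (Fin 4) k) (x : Ring k PEmpty RMonoidDefs.rDatum), f • x = MvPolynomial.aeval (thetaFun k) f * x :=
    fun f x => rfl
  -- linear independence over `k[Y]`
  have hli : LinearIndependent (MvPolynomial (Fin 4) k) (bElem k) := by
    rw [Fintype.linearIndependent_iff]
    intro g hg
    refine bElem_linearIndependent_aeval k g ?_
    simpa only [hsmul] using hg
  -- the degree pieces `M_t` lie in the `k[Y]`-span of `B`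
  have key : ∀ (t : ℕ) (y : Ring k PEmpty RMonoidDefs.rDatum),
      y ∈ Submodule.span k {x | ∃ (i : Fin 5) (a : Fin 4 → ℕ), (∑ s, a s) + bDeg i = t ∧ x = thetaPow k a * bElem k i} →
      y ∈ Submodule.span (MvPolynomial (Fin 4) k) (Set.range (bElem k)) := by
    intro t y hy
    induction hy using Submodule.span_induction with
    | mem y hy =>
      obtain ⟨i, a, -, rfl⟩ := hy
      rw [thetaPow_eq_aeval, ← hsmul]
      exact Submodule.smul_mem _ _ (Submodule.subset_span ⟨i, rfl⟩)
    | zero => exact Submodule.zero_mem _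
    | add y z _ _ hy hz => exact Submodule.add_mem _ hy hz
    | smul c y _ hy =>
      rw [show c • y = (MvPolynomial.C c : MvPolynomial (Fin 4) k) • y by rw [hsmul, MvPolynomial.aeval_C, Algebra.smul_def]]
      exact Submodule.smul_mem _ _ hy
  -- spanning over `k[Y]`
  have hsp : ⊤ ≤ Submodule.span (MvPolynomial (Fin 4) k) (Set.range (bElem k)) := by
    rintro r -
    have hr : r ∈ Submodule.span k (Set.range fun m : Fin 7 → ℕ => wordElem k PEmpty RMonoidDefs.rDatum (wordOf m)) := by
      rw [span_wordElem_wordOf_eq_top]; trivial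
    induction hr using Submodule.span_induction with
    | mem x hx =>
      obtain ⟨m, rfl⟩ := hx
      exact key _ _ (wordElem_wordOf_mem k (∑ j, m j) m rfl)
    | zero => exact Submodule.zero_mem _
    | add y z _ _ hy hz => exact Submodule.add_mem _ hy hz
    | smul c y _ hy =>
      rw [show c • y = (MvPolynomial.C c : MvPolynomial (Fin 4) k) • y by rw [hsmul, MvPolynomial.aeval_C, Algebra.smul_def]]
      exact Submodule.smul_mem _ _ hy
  let B := Module.Basis.mk hli hsp
  exact ⟨Module.Free.of_basis B, Module.Finite.of_basis B⟩

/-! ## §2 The Cohen–Macaulay clause at every prime and every stalk -/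

/-- **Every local ring of `U_R` is Cohen–Macaulay** (the crux's CM clause): `k[R]` is flat and integral over the regular ring `k[Y₀..Y₃]`.
[OURS · L1 W4.5a; cite: Hochster1972 (context), BrunsHerzog1998, Thm. 2.1.2] -/
theorem cmCl_localization_rDatum (P : Ideal (Ring k PEmpty RMonoidDefs.rDatum)) [P.IsPrime] : CMCl (Localization.AtPrime P) := by
  letI alg : Algebra (MvPolynomial (Fin 4) k) (Ring k PEmpty RMonoidDefs.rDatum) := (MvPolynomial.aeval (thetaFun k)).toRingHom.toAlgebra
  letI mod : Module (MvPolynomial (Fin 4) k) (Ring k PEmpty RMonoidDefs.rDatum) := alg.toModule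
  obtain ⟨hfree, hfin⟩ := free_and_finite k
  haveI : IsNoetherianRing (Ring k PEmpty RMonoidDefs.rDatum) := isNoetherianRing_ring k PEmpty RMonoidDefs.rDatum
  haveI : Algebra.IsIntegral (MvPolynomial (Fin 4) k) (Ring k PEmpty RMonoidDefs.rDatum) := Algebra.IsIntegral.of_finite _ _
  exact FlatIntegralCM.cmCl_localization_of_isRegularRing (A := MvPolynomial (Fin 4) k) P

/-- The same at the stalks of `U_R = Spec k[R]`. [OURS · L1 W4.5a] -/
theorem cmCl_stalk_rDatum (q : Spec (.of (Ring k PEmpty RMonoidDefs.rDatum))) :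
    CMCl ((Spec (.of (Ring k PEmpty RMonoidDefs.rDatum))).presheaf.stalk q) := by
  letI alg : Algebra (MvPolynomial (Fin 4) k) (Ring k PEmpty RMonoidDefs.rDatum) := (MvPolynomial.aeval (thetaFun k)).toRingHom.toAlgebra
  letI mod : Module (MvPolynomial (Fin 4) k) (Ring k PEmpty RMonoidDefs.rDatum) := alg.toModule
  obtain ⟨hfree, hfin⟩ := free_and_finite k
  haveI : IsNoetherianRing (Ring k PEmpty RMonoidDefs.rDatum) := isNoetherianRing_ring k PEmpty RMonoidDefs.rDatum
  haveI : Algebra.IsIntegral (MvPolynomial (Fin 4) k) (Ring k PEmpty RMonoidDefs.rDatum) := Algebra.IsIntegral.of_finite _ _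
  exact FlatIntegralCM.cmCl_stalk_Spec_of_isRegularRing (A := MvPolynomial (Fin 4) k) q

/-! ## §3 `FullCl` at every point of `U_R` -/

/-- ★★ **`U_R` is FULL at every prime**: for every field `k` of characteristic `p` and every prime `P` of `k[R]`, the local ring `k[R]_P` is a
domain, satisfies the Cohen–Macaulay clause, and has EVERY parameter ideal (indeed every ideal) Frobenius closed. [OURS · L1 W4.5a] -/
theorem fullCl_localization_rDatum (p : ℕ) [Fact p.Prime] [CharP k p] (P : Ideal (Ring k PEmpty RMonoidDefs.rDatum)) [P.IsPrime] :
    FullCl p (Localization.AtPrime P) := by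
  haveI := isDomain_ring (k := k) (P := PEmpty) (D := RMonoidDefs.rDatum)
  refine ⟨IsLocalization.isDomain_of_le_nonZeroDivisors _ P.primeCompl_le_nonZeroDivisors, fun d hd s hs => ⟨cmCl_localization_rDatum k P d hd s hs, ?_⟩⟩
  exact ToricRingSplitting.fClause_localization_toricRing p k PEmpty RMonoidDefs.rDatum (RMonoidSaturated.rDatum_saturated_prime p)
    (Localization.AtPrime P) P.primeCompl (Ideal.span (Set.range s))

/-- ★★ **`U_R` is FULL at every point** (stalk form). [OURS · L1 W4.5a] -/
theorem fullCl_stalk_rDatum (p : ℕ) [Fact p.Prime] [CharP k p] (q : Spec (.of (Ring k PEmpty RMonoidDefs.rDatum))) :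
    FullCl p ((Spec (.of (Ring k PEmpty RMonoidDefs.rDatum))).presheaf.stalk q) :=
  WFixAtNonClosedDimTwo.fullCl_of_ringEquiv p (Spec.stalkIso (.of _) q).commRingCatIsoToRingEquiv.symm (fullCl_localization_rDatum k p q.asIdeal)

/-! ## §4 The floor of T″-instance #6 is FULL at every closed point — unconditionally -/

/-- ★★★ **The floor `X₁ = Bl_{Sing_red} U_R` of T″-instance #6 is FULL at EVERY CLOSED POINT**, for every field `k` of characteristic `p` —
✓p701502 `RMonoidFloorFull.fullCl_stalk_floor_of_closed` with its T-TOR hypothesis `hR` discharged by `fullCl_stalk_rDatum`. [OURS · L1 W4.5a] -/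
theorem fullCl_stalk_floor_of_closed (p : ℕ) [Fact p.Prime] [CharP k p]
    (y : ↥(affineBlowup (Ideal.span (Set.range fun l : Fin 7 => wordElem k PEmpty RMonoidDefs.rDatum (RMonoidDefs.rJ l)))))
    (hyc : IsClosed ({y} : Set ↥(affineBlowup (Ideal.span (Set.range fun l : Fin 7 => wordElem k PEmpty RMonoidDefs.rDatum (RMonoidDefs.rJ l)))))) :
    FullCl p ((affineBlowup (Ideal.span (Set.range fun l : Fin 7 => wordElem k PEmpty RMonoidDefs.rDatum (RMonoidDefs.rJ l)))).presheaf.stalk y) :=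
  RMonoidFloorFull.fullCl_stalk_floor_of_closed p k (fun q _ => fullCl_stalk_rDatum k p q) y hyc

end Summit.ResolutionOfSingularities.ResolutionOfSingularities.Theorems.FInjectiveMacaulayfication.RMonoidFull

end
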